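import Literature.Probability.RandomPlanarGeometry.ObservableLimitPassageAE
import Literature.Probability.Process.StoppedValuePairing
import HarnessLib

/-!
# The martingale property passes to the scaling limit: discrete-martingale form, functionals continuous at almost every limit path

Topic `Literature/Probability/RandomPlanarGeometry`; theorems only. Companion of
`ObservableLimitPassageAE.lean` in the way `ObservableDiscretePassage.lean` is the companion of
`ObservableLimitPassage.lean`: the per-scale identity `E_k[(B - A) ψ(V^k_S)] = 0` of the
a.e.-continuous passage theorem
`Loewner.integral_cylinder_eq_zero_of_tendstoInDistribution_of_ae_continuousAt` is discharged by
Doob's optional sampling theorem (`Process.integral_smul_stoppedValue_sub_eq_zero`, Kallenberg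
2021, Thm. 7.12), so that the per-scale hypothesis is literally: a discrete filtration, a REAL
bounded martingale `F` (for percolation: the conditional crossing probability of a fixed crossing
event given the first `n` steps of the exploration — a Doob martingale by the domain Markov
property, Camia–Newman 2007, §5; Smirnov 2001), two stopping times `σ ≤ τ ≤ M` whose stopped values
approximate the level-stopped observable `N_u(V^k)` just after `s`, resp. `t`, off a small bad
event.  Conclusion: the cylinder identity `E_μ[(N_t(W) − N_s(W)) ψ(W_S)] = 0` for the scaling limit,
for functionals `N` that are measurable in the path, continuous in time along every path, bounded,
and jointly continuous at almost every LIMIT path.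

* `Loewner.integral_cylinder_eq_zero_of_discreteMartingales_of_ae_continuousAt` — PROVED.

## References

* F. Camia, C. M. Newman, Probab. Theory Related Fields 139 (2007) 473–519, §5. [CamiaNewman2007]
* D. Chelkak, H. Duminil-Copin, C. Hongler, A. Kemppainen, S. Smirnov, C. R. Math. 352 (2014),
  §3. [CDHKSCRAS2014]
* O. Kallenberg, *Foundations of Modern Probability*, 3rd ed. (2021), Thm. 7.12. [Kallenberg2021]
-/

noncomputable section

open MeasureTheory Filter Topology Set
open scoped NNReal ENNReal
open Literature.Probability.Process

namespace Literature.Probability.RandomPlanarGeometry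

namespace Loewner

section DiscretePassageAE

/-- **Optional sampling in cylinder form, real martingales**: for a real discrete martingale `F`,
stopping times `σ ≤ τ ≤ M`, random variables `X i` measurable for the stopped σ-algebra of `σ`, and a
bounded measurable `ψ`, `E[(F_τ − F_σ) ψ(X)] = 0`. (Kallenberg 2021, Thm. 7.12.)
[cite: Kallenberg2021, Thm. 7.12] -/
theorem integral_stoppedValue_sub_mul_cylinder_eq_zero_real {Ω₀ : Type*} {m₀ : MeasurableSpace Ω₀}
    {P₀ : Measure Ω₀} [IsFiniteMeasure P₀] {𝒢 : Filtration ℕ m₀} {F : ℕ → Ω₀ → ℝ}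
    (hF : Martingale F 𝒢 P₀) {σ τ : Ω₀ → WithTop ℕ} (hσ : IsStoppingTime 𝒢 σ)
    (hτ : IsStoppingTime 𝒢 τ) (hστ : σ ≤ τ) {M : ℕ} (hτM : ∀ ω, τ ω ≤ M)
    {n : ℕ} {X : Fin n → Ω₀ → ℝ} (hX : ∀ i, Measurable[hσ.measurableSpace] (X i))
    {ψ : (Fin n → ℝ) → ℝ} (hψ : Measurable ψ) {c : ℝ} (hψc : ∀ v, |ψ v| ≤ c) :
    ∫ ω, (stoppedValue F τ ω - stoppedValue F σ ω) * ψ (fun i ↦ X i ω) ∂P₀ = 0 := by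
  have hXm : Measurable[hσ.measurableSpace] fun ω (i : Fin n) ↦ X i ω :=
    @measurable_pi_lambda Ω₀ (Fin n) (fun _ ↦ ℝ) hσ.measurableSpace _ _ hX
  have hΨ : StronglyMeasurable[hσ.measurableSpace] fun ω ↦ ψ (fun i ↦ X i ω) :=
    (hψ.comp hXm).stronglyMeasurable
  have h := integral_smul_stoppedValue_sub_eq_zero hF hσ hτ hστ hτM hΨ.aestronglyMeasurable
    (c := c) (ae_of_all _ fun ω ↦ by rw [Real.norm_eq_abs]; exact hψc _)
  simpa only [smul_eq_mul, mul_comm] using h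

variable {Ω : Type*} {mΩ : MeasurableSpace Ω} {μ : Measure Ω} [IsProbabilityMeasure μ]
  {Ω' : ℕ → Type*} {mΩ' : ∀ k, MeasurableSpace (Ω' k)} {P : ∀ k, Measure (Ω' k)}
  [∀ k, IsProbabilityMeasure (P k)]
  [MeasurableSpace C(ℝ≥0, ℝ)] [OpensMeasurableSpace C(ℝ≥0, ℝ)]

/-- **The martingale property passes to the scaling limit — discrete real martingales,
functionals continuous at almost every limit path.**  Setting of
`integral_cylinder_eq_zero_of_tendstoInDistribution_of_ae_continuousAt`: driving processes
`V k → W` in distribution in `C([0, ∞), ℝ)`; a real bounded family of path functionals `N_u(w)`,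
measurable in `w`, continuous in `u` along every path, jointly continuous at `(u, W(ω))` for all
`u` for `μ`-a.e. `ω`; a bounded continuous cylinder test function `ψ` at times `S ≤ s`.
Hypothesis, for every scale `k`: a filtration `𝒢` on `ℕ`, a real `𝒢`-martingale `F`, stopping
times `σ ≤ τ ≤ M` such that every `V^k_u`, `u ≤ s`, is `𝒢_σ`-measurable, the stopped values
`F_σ`, `F_τ` are a.e. bounded by `C'`, and off an event `bad` with `P_k(bad) ≤ η_k` they
approximate `N_u(V^k)` within `ε_k` at some `u ∈ [s, s + Δ_k]`, resp. `[t, t + Δ_k]`, where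
`ε_k, Δ_k, η_k → 0`.  Conclusion: `E_μ[(N_t(W) - N_s(W)) ψ(W_S)] = 0`.
[cite: CDHKSCRAS2014, §3] [cite: CamiaNewman2007, §5] -/
theorem integral_cylinder_eq_zero_of_discreteMartingales_of_ae_continuousAt
    {W : ℝ≥0 → Ω → ℝ} (hWc : ∀ ω, Continuous (W · ω))
    {V : ∀ k, ℝ≥0 → Ω' k → ℝ} (hVc : ∀ k ω, Continuous (V k · ω))
    (hlaw : TendstoInDistribution (fun k ω ↦ (⟨fun u ↦ V k u ω, hVc k ω⟩ : C(ℝ≥0, ℝ))) atTop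
      (fun ω ↦ (⟨fun u ↦ W u ω, hWc ω⟩ : C(ℝ≥0, ℝ))) P μ)
    {N : ℝ≥0 → C(ℝ≥0, ℝ) → ℝ} (hNm : ∀ u, Measurable (N u)) (hNu : ∀ w, Continuous fun u ↦ N u w)
    (hNae : ∀ᵐ ω ∂μ, ∀ u, ContinuousAt (Function.uncurry N) (u, ⟨fun r ↦ W r ω, hWc ω⟩)) {C : ℝ}
    (hNC : ∀ u w, ‖N u w‖ ≤ C) (s t : ℝ≥0) {n : ℕ} {S : Fin n → ℝ≥0} (hS : ∀ i, S i ≤ s)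
    {ψ : (Fin n → ℝ) → ℝ} (hψc : Continuous ψ) (hψ1 : ∀ v, |ψ v| ≤ 1) {C' : ℝ} {ε Δ η : ℕ → ℝ≥0}
    (hε : Tendsto ε atTop (𝓝 0)) (hΔ : Tendsto Δ atTop (𝓝 0)) (hη : Tendsto η atTop (𝓝 0))
    (hD : ∀ k, ∃ (𝒢 : Filtration ℕ (mΩ' k)) (F : ℕ → Ω' k → ℝ) (σ τ : Ω' k → WithTop ℕ)
      (hσ : IsStoppingTime 𝒢 σ) (M : ℕ) (bad : Set (Ω' k)),
      IsStoppingTime 𝒢 τ ∧ Martingale F 𝒢 (P k) ∧ σ ≤ τ ∧ (∀ ω, τ ω ≤ M) ∧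
      (∀ u, u ≤ s → Measurable[hσ.measurableSpace] (V k u)) ∧
      (∀ᵐ ω ∂P k, ‖stoppedValue F σ ω‖ ≤ C') ∧ (∀ᵐ ω ∂P k, ‖stoppedValue F τ ω‖ ≤ C') ∧
      MeasurableSet bad ∧ P k bad ≤ η k ∧
      ∀ᵐ ω ∂P k, ω ∉ bad →
        (∃ u ∈ Icc s (s + Δ k), ‖stoppedValue F σ ω - N u ⟨fun r ↦ V k r ω, hVc k ω⟩‖ ≤ ε k) ∧
        (∃ u ∈ Icc t (t + Δ k), ‖stoppedValue F τ ω - N u ⟨fun r ↦ V k r ω, hVc k ω⟩‖ ≤ ε k)) :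
    ∫ ω, (N t ⟨fun u ↦ W u ω, hWc ω⟩ - N s ⟨fun u ↦ W u ω, hWc ω⟩) *
      ψ (fun i ↦ W (S i) ω) ∂μ = 0 := by
  refine integral_cylinder_eq_zero_of_tendstoInDistribution_of_ae_continuousAt hWc hVc hlaw hNm hNu
    hNae hNC s t S hψc hψ1 (C' := C') hε hΔ hη fun k ↦ ?_
  obtain ⟨𝒢, F, σ, τ, hσ, M, bad, hτ, hF, hστ, hτM, hVm, hbσ, hbτ, hbad, hPbad, happ⟩ := hD k
  have hσM : ∀ ω, σ ω ≤ M := fun ω ↦ (hστ ω).trans (hτM ω)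
  refine ⟨stoppedValue F σ, stoppedValue F τ, bad, hbad, hPbad,
    (integrable_stoppedValue ℕ hσ hF.integrable hσM).aestronglyMeasurable,
    (integrable_stoppedValue ℕ hτ hF.integrable hτM).aestronglyMeasurable, hbσ, hbτ, ?_, happ⟩
  exact integral_stoppedValue_sub_mul_cylinder_eq_zero_real hF hσ hτ hστ hτM
    (fun i ↦ hVm (S i) (hS i)) hψc.measurable hψ1

end DiscretePassageAE

end Loewner

end Literature.Probability.RandomPlanarGeometry

end
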